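import Summits.ResolutionOfSingularities.ResolutionOfSingularities.Theorems.MarkedTransferCampaignW12K12Box
import Mathlib.Algebra.Polynomial.Monic
import Mathlib.Algebra.Polynomial.HasseDeriv
import Mathlib.Tactic
import HarnessLib

/-!
# [OURS · L1 W1.2 · kill test K1.2, supplement K1.2-S] The second, disjoint check: the Example-C point `ξ′_b`
# under the Frobenius-sandwich negative modules — unit-free in every degree

Companion of `MarkedTransferCampaignW12K12Box.lean` / `…K12Witnesses.lean` (slot W1.2, seat res-L1-k12, same honest
framing — read the header of `…K12Box.lean` first). KILL-TEST K1.2 was scored DEAD 2026-08-26T21:02:49Z (ruled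
21:05:07Z): the unit is manufactured on W2 = R05 #1 by a BOX operator, while W1 (R08) and W3 (R05 #2) are unit-free in
every degree. Its report (HOME/L/res-L1-k12/KILL-TEST-K1.2.md §5) named the SECOND, DISJOINT CHECK that would confirm the
anatomy of that death («carried by the Artin–Schreier-type box monomial only»), and the director's ruling 21:05:07Z /
21:27:42Z made it an input of the slot's rung 1: recompute on ONE MORE witness of the row, the G-a **Example-C point**
`ξ′_b` of the prior record. Pre-registration of this supplement = HOME/STATUS.md «KILL-TEST K1.2-S REGISTERED»
2026-08-26T22:30:58Z (frozen copy HOME/L/res-L1-k12/PREREG-K1.2-S.md, sha16 46c77b21a229f233), filed with the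
PREDICTION «ALIVE-type» BEFORE any Lean run on this witness.

THE WITNESS W4. `E′ = (g₄, 2) ⊂ A³_K`, `g₄ = y″² + x₁²(s³ + c²s² + c⁴s)`, at the origin `ξ′` of `(y″, x₁, s)`
(frame `Fin 3`: `0 = y″`, `1 = x₁`, `2 = s`), `K` ANY field of characteristic `2`, `c ∈ K` arbitrary. By
`g4_eq_C_point` it is the first transform `y′² + x₁²x₂′³` of `D = (y² + x₁x₂³, 2)` (point blow-up, `x₁`-chart) re-centred
at `ξ′_b = (0, c², 0)` with the edge parameter `y″ = y′ + c³x₁` — the tree's `Campaign.K13.C_edge_form` (p466729,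
res-L1-k13) as an `MvPolynomial` identity. Its tail `ε′ = x₁²(s³+c²s²+c⁴s)` lies in `𝔪^{[2]} = (y″², x₁², s²)`.

WHAT IS PROVED (kernel, sorry-free, `[folklore]` identities over `K`):
* (C1) `g4_mem_sq`, (C2) `g4_mem_axis_sq` (the `s`-axis `V(y″,x₁) ⊂ Sing(E′)`: kills the box monomials `y″s`, `x₁s`),
  (C3) `g4_x1Chart` + `g4'_mem_sq` (point blow-up at `ξ′`, `x₁`-chart origin `∈ Sing`: kills `y″x₁`), bookkeeping
  `W4_box_exponents` (`decide`: only `γ = (1,1,1)` survives (C2)/(C3)), (C4) `g4_mem_movingCentre_sq` +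
  `g4_movingChart` + `g4_moving'_mem_sq` + `yx1s_movingChart` + `yx1s_moving'_not_mem` (the moving centre
  `V(y″, x₁, s − c² − λ²)` over `K[λ]` — the point `(0,0,τ)` of the `s`-axis with `τ(τ²+c²τ+c⁴) = t²` parametrised by
  `τ = c² + λ²`, `t = c³ + λ³` —, the `x₁`-chart re-centred at `Y = t`, then the `λ`-line `⊂ Sing`: the transform of
  `y″x₁s` restricts to `(c³+λ³)(c²+λ²) ≠ 0` on that line, a MONIC quintic in `λ`; coefficientwise, exactly as in
  KILL-TEST-K1.2.md §3, the `Y′`-component modulo `(Y′,x₁,S)²` of the transform of `f = Σ f_{jli} y″^j x₁^l s^i ∈ (y″,x₁)²`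
  is `Σ_i f_{11i} (c²+λ²)^i`, so `f_{11i} = 0` for every `i`).
* The schema instance `W4_sandwichPNega_le` / `W4_sandwichNegaNoUnit`: given `℘(E′,2) ⊆ 𝔪^{[2]}` (certified by
  (C1)–(C4)) and `℘(E′,2d) ⊆ 𝔪^{2d}` (`ξ′ ∈ Sing`), EVERY sandwich negative module `℘nega^sw(E′,−a)`, `a ≥ 1`
  (`e = 1`, `m = 2`) lies in `𝔪_{ξ′}`, and the typed `SandwichNegaNoUnit 2 1 P 2` (p461383) holds — the registered
  ALIVE-type answer, as predicted.
* Sensitivity row (b) (registered non-verdict-bearing): `hasseDeriv_two_g4` — `∂_{y″}^{(2)} g₄ = 1`, so every operator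
  class containing `∂_{y″}^{(2)}` (absolute `Diff`, the `x`-Cartier reading, the sandwich of level `e′ ≥ 2`) manufactures
  the unit from `g₄ ∈ ℘(E′,2)` in every degree — DEAD-trivially under those readings, as for W1–W3.

NOT statements of the manuscript ([Hironaka2017], lit key `paper:url-3343fd9e678b`); OURS objects; nothing here is
progress on resolution of singularities in positive characteristic; AI computation is weaker than expert review.
Host item `--supports stmt-ResolutionOfSingularities-15522` (as for the K1.2 files).
-/

noncomputable section

set_option linter.dupNamespace false

namespace Summit.ResolutionOfSingularities.ResolutionOfSingularities.Theorems.Campaign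

open Literature.AlgebraicGeometry.Resolution
open Literature.AlgebraicGeometry.Hironaka2017
open MvPolynomial

section W4

variable {K : Type*} [Field K] [CharP K 2] (c : K)

/-- W4 is the recorded Example-C point: substituting the edge coordinates `y′ = y″ + c³x₁`, `x₂′ = s + c²` into the
first transform `y′² + x₁²x₂′³` of `D = (y² + x₁x₂³, 2)` gives `g₄ = y″² + x₁²(s³ + c²s² + c⁴s)` (characteristic `2`;
the `MvPolynomial` form of `Campaign.K13.C_edge_form`). [folklore] -/
theorem g4_eq_C_point :
    aeval ![X 0 + C c ^ 3 * X 1, X 1, X 2 + C c ^ 2] (X 0 ^ 2 + X 1 ^ 2 * X 2 ^ 3 : MvPolynomial (Fin 3) K)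
      = (X 0 ^ 2 + X 1 ^ 2 * (X 2 ^ 3 + C c ^ 2 * X 2 ^ 2 + C c ^ 4 * X 2) : MvPolynomial (Fin 3) K) := by
  have h2 : (2 : MvPolynomial (Fin 3) K) = 0 := CharTwo.two_eq_zero
  simp only [map_add, map_mul, map_pow, aeval_X]
  simp [Matrix.cons_val]
  linear_combination (C c ^ 3 * X 0 * X 1 + C c ^ 6 * X 1 ^ 2 + C c ^ 2 * X 1 ^ 2 * X 2 ^ 2
    + C c ^ 4 * X 1 ^ 2 * X 2 : MvPolynomial (Fin 3) K) * h2

omit [CharP K 2] in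
/-- (C1) `g₄ ∈ 𝔪₀²`: `ξ′ ∈ Sing(E′)` (a point of order `2 = b`), hence `℘(E′, j) ⊆ 𝔪₀^j` (point blow-up permissible)
and (37) holds at `ξ′` with `m = q = 2`. [folklore] -/
theorem g4_mem_sq :
    (X 0 ^ 2 + X 1 ^ 2 * (X 2 ^ 3 + C c ^ 2 * X 2 ^ 2 + C c ^ 4 * X 2) : MvPolynomial (Fin 3) K)
      ∈ idealOfVars (Fin 3) K ^ 2 := by
  have hX : ∀ i : Fin 3, (X i : MvPolynomial (Fin 3) K) ∈ idealOfVars (Fin 3) K :=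
    fun i => Ideal.subset_span (Set.mem_range_self i)
  rw [pow_two]
  refine Ideal.add_mem _ ?_ ?_
  · rw [pow_two]; exact Ideal.mul_mem_mul (hX 0) (hX 0)
  · rw [pow_two, mul_assoc]; exact Ideal.mul_mem_mul (hX 1) (Ideal.mul_mem_right _ _ (hX 1))

omit [CharP K 2] in
/-- (C2) `g₄ ∈ (y″, x₁)²`: the `s`-axis `V(y″, x₁)` lies in `Sing(E′)` (order `2` along it), so blowing it up is
permissible for `E′`, hence for `((f), 2)` whenever `f ∈ ℘(E′, 2)`: `℘(E′,2) ⊆ (y″,x₁)²` — the box monomials `y″s`,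
`x₁s` (`γ_{y″} + γ_{x₁} = 1 < 2`) have zero coefficient. [folklore] -/
theorem g4_mem_axis_sq :
    (X 0 ^ 2 + X 1 ^ 2 * (X 2 ^ 3 + C c ^ 2 * X 2 ^ 2 + C c ^ 4 * X 2) : MvPolynomial (Fin 3) K)
      ∈ (Ideal.span {(X 0 : MvPolynomial (Fin 3) K), X 1}) ^ 2 := by
  have h0 : (X 0 : MvPolynomial (Fin 3) K) ∈ Ideal.span {(X 0 : MvPolynomial (Fin 3) K), X 1} :=
    Ideal.subset_span (by simp)
  have h1 : (X 1 : MvPolynomial (Fin 3) K) ∈ Ideal.span {(X 0 : MvPolynomial (Fin 3) K), X 1} :=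
    Ideal.subset_span (by simp)
  rw [pow_two]
  refine Ideal.add_mem _ ?_ ?_
  · rw [pow_two]; exact Ideal.mul_mem_mul h0 h0
  · rw [pow_two, mul_assoc]; exact Ideal.mul_mem_mul h1 (Ideal.mul_mem_right _ _ h1)

omit [CharP K 2] in
/-- (C3) Point blow-up at `ξ′`, `x₁`-chart `y″ = y‴x₁`, `x₁ = x₁`, `s = s′x₁`:
`g₄ ↦ x₁² · (y‴² + c⁴x₁s′ + c²x₁²s′² + x₁³s′³)` (controlled transform in the bracket; `Campaign.K13.C_neg`'s `g₂`).
[folklore] -/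
theorem g4_x1Chart :
    aeval ![X 0 * X 1, X 1, X 2 * X 1]
        (X 0 ^ 2 + X 1 ^ 2 * (X 2 ^ 3 + C c ^ 2 * X 2 ^ 2 + C c ^ 4 * X 2) : MvPolynomial (Fin 3) K)
      = (X 1 ^ 2 * (X 0 ^ 2 + C c ^ 4 * X 1 * X 2 + C c ^ 2 * X 1 ^ 2 * X 2 ^ 2 + X 1 ^ 3 * X 2 ^ 3) :
          MvPolynomial (Fin 3) K) := by
  simp only [map_add, map_mul, map_pow, aeval_X, aeval_C, algebraMap_eq]
  simp [Matrix.cons_val]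
  ring

omit [CharP K 2] in
/-- (C3) The `x₁`-chart origin is a point of order `2` of `E″ = (y‴² + c⁴x₁s′ + c²x₁²s′² + x₁³s′³, 2)`: blowing it up is
permissible for `E″`. For `f = Σ f_{jli} y″^j x₁^l s^i ∈ ℘(E′,2)` the controlled transform is
`Σ f_{jli} y‴^j x₁^{j+l+i−2} s′^i` (distinct monomials stay distinct), so permissibility for `((f′),2)` reads
`2j + l + 2i ≥ 4` on the support: the box monomial `y″x₁` (`(1,1,0)`: `3 < 4`) has zero coefficient. [folklore] -/
theorem g4'_mem_sq :
    (X 0 ^ 2 + C c ^ 4 * X 1 * X 2 + C c ^ 2 * X 1 ^ 2 * X 2 ^ 2 + X 1 ^ 3 * X 2 ^ 3 : MvPolynomial (Fin 3) K)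
      ∈ idealOfVars (Fin 3) K ^ 2 := by
  have hX : ∀ i : Fin 3, (X i : MvPolynomial (Fin 3) K) ∈ idealOfVars (Fin 3) K :=
    fun i => Ideal.subset_span (Set.mem_range_self i)
  rw [pow_two]
  refine Ideal.add_mem _ (Ideal.add_mem _ (Ideal.add_mem _ ?_ ?_) ?_) ?_
  · rw [pow_two]; exact Ideal.mul_mem_mul (hX 0) (hX 0)
  · exact Ideal.mul_mem_mul (Ideal.mul_mem_left _ _ (hX 1)) (hX 2)
  · rw [show (C c ^ 2 * X 1 ^ 2 * X 2 ^ 2 : MvPolynomial (Fin 3) K) = (C c ^ 2 * X 1 ^ 2 * X 2) * X 2 by ring]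
    exact Ideal.mul_mem_mul (Ideal.mul_mem_left _ _ (hX 2)) (hX 2)
  · rw [show (X 1 ^ 3 * X 2 ^ 3 : MvPolynomial (Fin 3) K) = (X 1 ^ 3 * X 2 ^ 2) * X 2 by ring]
    exact Ideal.mul_mem_mul (Ideal.mul_mem_right _ _ (Ideal.pow_mem_of_mem _ (hX 1) 3 (by norm_num))) (hX 2)

/-- Bookkeeping for (C2)/(C3) (`decide`): every box exponent `γ ∈ {0,1}³` (order `y″, x₁, s`) of degree `≥ 2`
violates (C2) (`γ_{y″} + γ_{x₁} ≥ 2`) or (C3) (`2γ_{y″} + γ_{x₁} + 2γ_s ≥ 4`), except `γ = (1,1,1)` (the monomial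
`y″x₁s`). [folklore] -/
theorem W4_box_exponents :
    ∀ γ : Fin 3 → Fin 2, 2 ≤ (γ 0 : ℕ) + γ 1 + γ 2 →
      ((γ 0 : ℕ) + γ 1 < 2 ∨ 2 * (γ 0 : ℕ) + γ 1 + 2 * γ 2 < 4) ∨ γ = ![1, 1, 1] := by
  decide

omit [CharP K 2] in
/-- (C4) The moving centre. Base-extend by an indeterminate `λ` (frame `Fin 4`: `3 = λ`) and take the smooth curve
`C_λ = V(y″, x₁, s − c² − λ²) ⊂ Sing(E′[λ]) ⊇ V(y″, x₁)` — the point `(0, 0, τ)`, `τ = c² + λ²`, of the `s`-axis;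
permissible since `g₄ ∈ (y″, x₁)² ⊆ I(C_λ)²`. [folklore] -/
theorem g4_mem_movingCentre_sq :
    (X 0 ^ 2 + X 1 ^ 2 * (X 2 ^ 3 + C c ^ 2 * X 2 ^ 2 + C c ^ 4 * X 2) : MvPolynomial (Fin 4) K)
      ∈ (Ideal.span {(X 0 : MvPolynomial (Fin 4) K), X 1, X 2 + C c ^ 2 + X 3 ^ 2}) ^ 2 := by
  have h0 : (X 0 : MvPolynomial (Fin 4) K) ∈ Ideal.span {(X 0 : MvPolynomial (Fin 4) K), X 1, X 2 + C c ^ 2 + X 3 ^ 2} :=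
    Ideal.subset_span (by simp)
  have h1 : (X 1 : MvPolynomial (Fin 4) K) ∈ Ideal.span {(X 0 : MvPolynomial (Fin 4) K), X 1, X 2 + C c ^ 2 + X 3 ^ 2} :=
    Ideal.subset_span (by simp)
  have key := Ideal.add_mem _ (Ideal.mul_mem_mul h0 h0)
    (Ideal.mul_mem_mul h1 (Ideal.mul_mem_right (X 2 ^ 3 + C c ^ 2 * X 2 ^ 2 + C c ^ 4 * X 2) _ h1))
  simpa only [pow_two, mul_assoc] using key

/-- (C4) The `x₁`-chart of the blow-up of `C_λ`, re-centred at the point `Y = t := c³ + λ³` of the exceptional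
divisor (the unique singular point of the transform there: `t² = τ³ + c²τ² + c⁴τ` for `τ = c² + λ²`, characteristic
`2`): `y″ = (Y′ + c³ + λ³)·x₁`, `x₁ = x₁`, `s = S·x₁ + c² + λ²`. Then
`g₄ ↦ x₁² · (Y′² + λ⁴x₁S + λ²x₁²S² + x₁³S³)` (frame `Fin 4`: `0 = Y′`, `1 = x₁`, `2 = S`, `3 = λ`). [folklore] -/
theorem g4_movingChart :
    aeval ![(X 0 + C c ^ 3 + X 3 ^ 3) * X 1, X 1, X 2 * X 1 + C c ^ 2 + X 3 ^ 2]
        (X 0 ^ 2 + X 1 ^ 2 * (X 2 ^ 3 + C c ^ 2 * X 2 ^ 2 + C c ^ 4 * X 2) : MvPolynomial (Fin 3) K)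
      = (X 1 ^ 2 * (X 0 ^ 2 + X 3 ^ 4 * X 1 * X 2 + X 3 ^ 2 * X 1 ^ 2 * X 2 ^ 2 + X 1 ^ 3 * X 2 ^ 3) :
          MvPolynomial (Fin 4) K) := by
  have h2 : (2 : MvPolynomial (Fin 4) K) = 0 := CharTwo.two_eq_zero
  simp only [map_add, map_mul, map_pow, aeval_X, aeval_C, algebraMap_eq]
  simp [Matrix.cons_val]
  linear_combination (X 1 ^ 2 * (X 0 * (C c ^ 3 + X 3 ^ 3) + 2 * C c ^ 6 + C c ^ 3 * X 3 ^ 3 + X 3 ^ 6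
      + 3 * C c ^ 4 * X 3 ^ 2 + 2 * C c ^ 2 * X 3 ^ 4 + (3 * C c ^ 4 + 4 * C c ^ 2 * X 3 ^ 2 + X 3 ^ 4) * X 1 * X 2
      + (2 * C c ^ 2 + X 3 ^ 2) * X 1 ^ 2 * X 2 ^ 2) : MvPolynomial (Fin 4) K) * h2

omit [CharP K 2] in
/-- (C4) The `λ`-line `L = V(Y′, x₁, S)` lies in `Sing` of the transform `(Y′² + λ⁴x₁S + λ²x₁²S² + x₁³S³, 2)` (order
`2` along it): blowing it up is permissible, so `f′ ∈ (Y′, x₁, S)²` for the controlled transform `f′` of every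
`f ∈ ℘(E′, 2)`. [folklore] -/
theorem g4_moving'_mem_sq :
    (X 0 ^ 2 + X 3 ^ 4 * X 1 * X 2 + X 3 ^ 2 * X 1 ^ 2 * X 2 ^ 2 + X 1 ^ 3 * X 2 ^ 3 : MvPolynomial (Fin 4) K)
      ∈ (Ideal.span {(X 0 : MvPolynomial (Fin 4) K), X 1, X 2}) ^ 2 := by
  have h0 : (X 0 : MvPolynomial (Fin 4) K) ∈ Ideal.span {(X 0 : MvPolynomial (Fin 4) K), X 1, X 2} :=
    Ideal.subset_span (by simp)
  have h1 : (X 1 : MvPolynomial (Fin 4) K) ∈ Ideal.span {(X 0 : MvPolynomial (Fin 4) K), X 1, X 2} :=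
    Ideal.subset_span (by simp)
  have h2 : (X 2 : MvPolynomial (Fin 4) K) ∈ Ideal.span {(X 0 : MvPolynomial (Fin 4) K), X 1, X 2} :=
    Ideal.subset_span (by simp)
  rw [pow_two]
  refine Ideal.add_mem _ (Ideal.add_mem _ (Ideal.add_mem _ ?_ ?_) ?_) ?_
  · rw [pow_two]; exact Ideal.mul_mem_mul h0 h0
  · exact Ideal.mul_mem_mul (Ideal.mul_mem_left _ _ h1) h2
  · rw [show (X 3 ^ 2 * X 1 ^ 2 * X 2 ^ 2 : MvPolynomial (Fin 4) K) = (X 3 ^ 2 * X 1 ^ 2 * X 2) * X 2 by ring]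
    exact Ideal.mul_mem_mul (Ideal.mul_mem_left _ _ h2) h2
  · rw [show (X 1 ^ 3 * X 2 ^ 3 : MvPolynomial (Fin 4) K) = (X 1 ^ 3 * X 2 ^ 2) * X 2 by ring]
    exact Ideal.mul_mem_mul (Ideal.mul_mem_left _ _ (Ideal.pow_mem_of_mem _ h2 2 (by norm_num))) h2

omit [CharP K 2] in
/-- (C4) The controlled transform of the box monomial `y″x₁s` under the moving chart is `(Y′ + c³ + λ³)(Sx₁ + c² + λ²)`:
`y″x₁s ↦ x₁² · (Y′ + c³ + λ³)(Sx₁ + c² + λ²)`. [folklore] -/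
theorem yx1s_movingChart :
    aeval ![(X 0 + C c ^ 3 + X 3 ^ 3) * X 1, X 1, X 2 * X 1 + C c ^ 2 + X 3 ^ 2]
        (X 0 * X 1 * X 2 : MvPolynomial (Fin 3) K)
      = (X 1 ^ 2 * ((X 0 + C c ^ 3 + X 3 ^ 3) * (X 2 * X 1 + C c ^ 2 + X 3 ^ 2)) : MvPolynomial (Fin 4) K) := by
  simp only [map_mul, aeval_X]
  simp [Matrix.cons_val]
  ring

omit [CharP K 2] in
/-- (C4) `(Y′ + c³ + λ³)(Sx₁ + c² + λ²) ∉ (Y′, x₁, S)`: it restricts to `(c³ + λ³)(c² + λ²)` on `L`, a MONIC quintic in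
`λ` (hence nonzero, for every `c`, also `c = 0`) — so a fortiori `∉ (Y′, x₁, S)²`: `y″x₁s ∉ ℘(E′, 2)`.
Coefficientwise (the prose step, KILL-TEST-K1.2.md §3 / KILL-TEST-K1.2-S.md): modulo `(Y′,x₁,S)²` the transform of
`f = Σ f_{jli} y″^j x₁^l s^i ∈ (y″,x₁)²` has `Y′`-component `Σ_i f_{11i} (c²+λ²)^i ∈ K[λ]`, so `f_{11i} = 0` for all `i`
(substitution of the non-constant `c² + λ²` is injective on `K[T]`); in particular the `y″x₁s`-coefficient of every
`f ∈ ℘(E′,2)` vanishes. [folklore] -/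
theorem yx1s_moving'_not_mem :
    ((X 0 + C c ^ 3 + X 3 ^ 3) * (X 2 * X 1 + C c ^ 2 + X 3 ^ 2) : MvPolynomial (Fin 4) K)
      ∉ Ideal.span {(X 0 : MvPolynomial (Fin 4) K), X 1, X 2} := by
  intro h
  have hle : Ideal.span {(X 0 : MvPolynomial (Fin 4) K), X 1, X 2}
      ≤ RingHom.ker (aeval ![(0 : Polynomial K), 0, 0, Polynomial.X]).toRingHom := by
    refine Ideal.span_le.2 ?_
    intro f hf
    simp only [Set.mem_insert_iff, Set.mem_singleton_iff] at hf
    rcases hf with rfl | rfl | rfl <;> simp [RingHom.mem_ker, Matrix.cons_val]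
  have h0 := hle h
  simp only [RingHom.mem_ker, AlgHom.toRingHom_eq_coe, RingHom.coe_coe, map_mul, map_add, map_pow,
    aeval_X, aeval_C, Polynomial.algebraMap_eq] at h0
  simp [Matrix.cons_val] at h0
  -- `K[λ]` is a domain: one of the two monic factors would vanish
  rcases h0 with h0 | h0
  · exact (Polynomial.monic_X_pow_add_C (a := c ^ 3) (n := 3) (by norm_num)).ne_zero
      (by rw [map_pow]; linear_combination h0)
  · exact (Polynomial.monic_X_pow_add_C (a := c ^ 2) (n := 2) (by norm_num)).ne_zero
      (by rw [map_pow]; linear_combination h0)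

/-- **K1.2-S, witness W4 (Example-C point) — ALIVE-type row (kernel part), as predicted in the preregistration.**
For every family `P` with `P 2 ⊆ 𝔪₀^{[2]} = (y″², x₁², s²)` (certified for `℘(E′,2)` by (C1)–(C4) + `W4_box_exponents`)
and `P(2d) ⊆ 𝔪₀^{2d}` for `d ≥ 2` (`ξ′ ∈ Sing`), EVERY Frobenius-sandwich negative module `℘nega^sw(E′,−a)`, `a ≥ 1`
(level `e = 1`, `m = 2`) lies in `𝔪₀`: no unit at `ξ′` in any degree — whereas the absolute modules contain
`∂_{y″}^{(2)} g₄ = 1` (`hasseDeriv_two_g4`). Confirms the anatomy of K1.2's DEAD on a witness disjoint from W1–W3.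
NOT a statement of the manuscript. [folklore] -/
theorem W4_sandwichPNega_le (P : ℕ → Ideal (MvPolynomial (Fin 3) K))
    (hP2 : P 2 ≤ Ideal.span (Set.range fun i : Fin 3 => (X i : MvPolynomial (Fin 3) K) ^ 2))
    (hP : ∀ d : ℕ, 2 ≤ d → P (d * 2) ≤ idealOfVars (Fin 3) K ^ (d * 2)) (a : ℕ) :
    sandwichPNega 2 1 P 2 a ≤ idealOfVars (Fin 3) K :=
  sandwichPNega_le_idealOfVars 2 1 P 2 a fun d hd _ => by
    rcases Nat.lt_or_ge d 2 with h | h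
    · obtain rfl : d = 1 := by omega
      simpa using hP2
    · have h4 : idealOfVars (Fin 3) K ^ (d * 2)
          ≤ idealOfVars (Fin 3) K ^ (3 * (2 - 1) + 1) := Ideal.pow_le_pow_right (by omega)
      exact (hP d h).trans (h4.trans (by simpa using pow_idealOfVars_le_frobPow (n := 3) (k := K) 2))

/-- **K1.2-S, witness W4 — the typed `Prop` holds.** Under the same certified hypotheses the typed
`SandwichNegaNoUnit 2 1 P 2` (res-L1-type-o2, p461383) holds over `K[y″, x₁, s]`. [folklore] -/
theorem W4_sandwichNegaNoUnit (P : ℕ → Ideal (MvPolynomial (Fin 3) K))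
    (hP2 : P 2 ≤ Ideal.span (Set.range fun i : Fin 3 => (X i : MvPolynomial (Fin 3) K) ^ 2))
    (hP : ∀ d : ℕ, 2 ≤ d → P (d * 2) ≤ idealOfVars (Fin 3) K ^ (d * 2)) :
    SandwichNegaNoUnit 2 1 P 2 := fun a _ h1 =>
  one_not_mem_idealOfVars (W4_sandwichPNega_le P hP2 hP a h1)

omit [CharP K 2] in
/-- Sensitivity row (b) of the preregistration (non-verdict-bearing): `∂_{y″}^{(2)} g₄ = 1` — `g₄ = y″² + ε′` as a
polynomial in `y″` over `K[x₁, s]` (frame `Fin 2`: `0 = x₁`, `1 = s`). Hence every operator class containing the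
second Hasse derivative in `y″` — the absolute `Diff`, the `x`-Cartier-extension reading, the sandwich of level
`e′ ≥ 2` (`2 < p^{e′}`) — turns `g₄ ∈ ℘(E′,2)` into the unit in every negative degree: DEAD-trivially under those
readings, exactly as for W1–W3 (`Nega.hasseDeriv_two_g`). [folklore] -/
theorem hasseDeriv_two_g4 :
    Polynomial.hasseDeriv 2
        (Polynomial.X ^ 2 + Polynomial.C (X 0 ^ 2 * (X 1 ^ 3 + C c ^ 2 * X 1 ^ 2 + C c ^ 4 * X 1) :
          MvPolynomial (Fin 2) K) : Polynomial (MvPolynomial (Fin 2) K)) = 1 := by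
  rw [Polynomial.X_pow_eq_monomial, map_add, Polynomial.hasseDeriv_C (k := 2) _ (by norm_num), add_zero,
    Polynomial.hasseDeriv_monomial]
  simp

end W4

end Summit.ResolutionOfSingularities.ResolutionOfSingularities.Theorems.Campaign
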